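import Summits.SmoothPoincare4.SmoothPoincare4.Theorems.CylinderEntropyCylinderRungTwoFluxIdentityPushOff
import HarnessLib

/-!
# Flux identity, part 6: the two sides of the cross-section and the crossing of a vertical line

Part of the proof of the stub `stub_fluxIdentity` (the FLUX IDENTITY `|∫_M ν₅ d(ι^*μH⁴)| = μH⁴(S⁴)`
for connected compact cross-sections of `N = S⁴ × ℝ ⊂ ℝ⁶`) of line `killing-flux` of the crux
`CylinderEntropy.CylinderRungTwo` (stmt-SmoothPoincare4-7631); see the final file
`CylinderEntropyCylinderRungTwoFluxIdentity.lean` for the overall argument. Everything here is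
proved (no named facts); theorems only.

* `exists_joinedIn_pushoffs` — push-offs in two transverse directions on the same side are joined
  in `N ∖ ι(M)`;
* `exists_side_constants` — the `±ν` push-offs define two sides `a₊, a₋` (path-connectedness of
  the connected manifold `M`);
* `low_vert_iff_near_crossing` — just above/below a regular crossing `ι x` (`ν₅ ≠ 0`) the vertical
  line is on the side `a_{± sign ν₅}`.
-/

-- the prescribed namespace `Summit.SmoothPoincare4.SmoothPoincare4.…` repeats `SmoothPoincare4`
set_option linter.dupNamespace false

noncomputable section

open MeasureTheory Set Function Filter Module
open scoped Manifold ContDiff ENNReal Topology RealInnerProductSpace NNReal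

namespace Summit.SmoothPoincare4.SmoothPoincare4.Theorems.CylinderRungTwo.KillingFlux

open Literature.Geometry.Riemannian
open Literature.Geometry.Lorentzian Literature.Geometry.Lorentzian.PseudoRiemannianMetric
open Literature.Geometry.Riemannian.SphericalCylinderEntropy (truncL truncL_apply lipschitz_truncL
  hausdorffMeasure_sphere_four_pos hausdorffMeasure_sphere_four_lt_top)
open Literature.Geometry.Manifold.CylinderSlice (axis castSucc_ne_five)

section Normalisation

section Sides

open Literature.Geometry.Manifold.CylinderSlice (padL padL_apply_castSucc padL_apply_last)

variable {M : Type}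

variable [TopologicalSpace M] [ChartedSpace (EuclideanSpace ℝ (Fin 4)) M] [IsManifold (𝓡 4) ∞ M]

/-- **Connecting two push-offs on the same side.** If `η, κ` are directions tangent to `N` at `ι x`
with `⟪(1-s)η + sκ, ν x⟫ ≠ 0` for all `s ∈ [0,1]` (both on the same side of the cross-section),
then for all small `t > 0` the normalised push-offs `nrm(ι x + tη)`, `nrm(ι x + tκ)` are joined in
`N ∖ ι(M)` (by the path `s ↦ nrm(ι x + t((1-s)η + sκ))`, uniform push-off lemma). [folklore] -/
theorem exists_joinedIn_pushoffs {ι ν : M → (EuclideanSpace ℝ (Fin 6))}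
    (hι : Manifold.IsSmoothEmbedding (𝓡 4) (𝓡 6) ∞ ι)
    (hιN : ∀ x, ∑ i : Fin 5, ι x (Fin.castSucc i) ^ 2 = 1)
    (hνn : (euclideanMetric (EuclideanSpace ℝ (Fin 6))).IsUnitNormal (𝓡 4) ι ν 1)
    (x : M) {η κ : (EuclideanSpace ℝ (Fin 6))} (hη : ∑ i : Fin 5, η (Fin.castSucc i) * ι x (Fin.castSucc i) = 0)
    (hκ : ∑ i : Fin 5, κ (Fin.castSucc i) * ι x (Fin.castSucc i) = 0)
    (hside : ∀ s ∈ Icc (0 : ℝ) 1, ⟪(1 - s) • η + s • κ, ν x⟫ ≠ 0) :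
    ∃ t₁ : ℝ, 0 < t₁ ∧ ∀ t ∈ Ioc (0 : ℝ) t₁,
      JoinedIn (({z : EuclideanSpace ℝ (Fin 6) | ∑ i : Fin 5, z (Fin.castSucc i) ^ 2 = 1} : Set (EuclideanSpace ℝ
            (Fin 6))) \ range ι) ((fun z : EuclideanSpace ℝ (Fin 6) => (‖truncL z‖⁻¹ : ℝ) • (z - z (5 : Fin 6) •
            (axis : EuclideanSpace ℝ (Fin 6))) + z (5 : Fin 6) • (axis : EuclideanSpace ℝ (Fin 6))) (ι x + t •
            η)) ((fun z : EuclideanSpace ℝ (Fin 6) => (‖truncL z‖⁻¹ : ℝ) • (z - z (5 : Fin 6) • (axis :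
            EuclideanSpace ℝ (Fin 6))) + z (5 : Fin 6) • (axis : EuclideanSpace ℝ (Fin 6))) (ι x + t • κ)) := by
  set g : Icc (0 : ℝ) 1 → (EuclideanSpace ℝ (Fin 6)) := fun s => (1 - (s : ℝ)) • η + (s : ℝ) • κ with hg
  have hgc : Continuous g := by
    rw [hg]; fun_prop
  have hgt : ∀ s : Icc (0 : ℝ) 1, ∑ i : Fin 5, g s (Fin.castSucc i) * ι x (Fin.castSucc i) = 0 := by
    intro s
    simp only [hg, PiLp.add_apply, PiLp.smul_apply, smul_eq_mul, add_mul, Finset.sum_add_distrib,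
      mul_assoc, ← Finset.mul_sum, hη, hκ, mul_zero, add_zero]
  obtain ⟨t₁, ht₁, hpo⟩ := exists_pushoff_notMem_range hι hιN hνn (P := Icc (0 : ℝ) 1)
    (f := fun _ => x) continuous_const hgc hgt (fun s => hside s s.2)
  refine ⟨t₁, ht₁, fun t ht => ?_⟩
  -- the path `s ↦ nrm(ι x + t g s)` over `[0,1]`
  set F : ℝ → (EuclideanSpace ℝ (Fin 6)) := fun s => (fun z : EuclideanSpace ℝ (Fin 6) => (‖truncL z‖⁻¹ : ℝ) • (z -
        z (5 : Fin 6) • (axis : EuclideanSpace ℝ (Fin 6))) + z (5 : Fin 6) • (axis : EuclideanSpace ℝ (Fin 6))) (ι x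
        + t • ((1 - s) • η + s • κ)) with hF
  have hFc : ContinuousOn F (Icc (0 : ℝ) 1) := by
    have hinner : Continuous fun s : ℝ => ι x + t • ((1 - s) • η + s • κ) := by fun_prop
    refine continuousOn_nrm.comp_continuous hinner (fun s => ?_) |>.continuousOn
    show truncL (ι x + t • ((1 - s) • η + s • κ)) ≠ 0
    refine (norm_nrm_sub_le (hιN x) ?_ t).1
    simp only [PiLp.add_apply, PiLp.smul_apply, smul_eq_mul, add_mul, Finset.sum_add_distrib,
      mul_assoc, ← Finset.mul_sum, hη, hκ, mul_zero, add_zero]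
  have hpath : IsPathConnected (F '' Icc (0 : ℝ) 1) :=
    ((convex_Icc (0 : ℝ) 1).isPathConnected ⟨0, by simp⟩).image' hFc
  have hsub : F '' Icc (0 : ℝ) 1 ⊆ ({z : EuclideanSpace ℝ (Fin 6) | ∑ i : Fin 5, z (Fin.castSucc i) ^ 2 = 1} : Set
        (EuclideanSpace ℝ (Fin 6))) \ range ι := by
    rintro _ ⟨s, hs, rfl⟩
    have hgs : ∑ i : Fin 5, ((1 - s) • η + s • κ) (Fin.castSucc i) * ι x (Fin.castSucc i) = 0 :=
      hgt ⟨s, hs⟩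
    exact nrm_pushoff_mem hιN hgs (hpo ⟨s, hs⟩ t ht)
  have h0 : F 0 = (fun z : EuclideanSpace ℝ (Fin 6) => (‖truncL z‖⁻¹ : ℝ) • (z - z (5 : Fin 6) • (axis :
        EuclideanSpace ℝ (Fin 6))) + z (5 : Fin 6) • (axis : EuclideanSpace ℝ (Fin 6))) (ι x + t •
        η) := by simp [hF]
  have h1 : F 1 = (fun z : EuclideanSpace ℝ (Fin 6) => (‖truncL z‖⁻¹ : ℝ) • (z - z (5 : Fin 6) • (axis :
        EuclideanSpace ℝ (Fin 6))) + z (5 : Fin 6) • (axis : EuclideanSpace ℝ (Fin 6))) (ι x + t •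
        κ) := by simp [hF]
  rw [← h0, ← h1]
  exact (hpath.joinedIn (F 0) (mem_image_of_mem F (by simp)) (F 1) (mem_image_of_mem F (by simp))).mono hsub

/-- `⟪e₅, v⟫ = v₅`. [folklore] -/
theorem inner_axis_left (v : (EuclideanSpace ℝ (Fin 6))) : ⟪(axis : (EuclideanSpace ℝ (Fin 6))), v⟫ = v 5 := by
  simp [axis, EuclideanSpace.inner_single_left]

/-- The vertical direction `± e₅` is tangent to `N`. [folklore] -/
theorem sum_axis_mul (c : ℝ) (z : (EuclideanSpace ℝ (Fin 6))) : ∑ i : Fin 5, (c • (axis : (EuclideanSpace ℝ (Fin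
      6)))) (Fin.castSucc i) * z (Fin.castSucc i) = 0 := by
  simp [axis, castSucc_ne_five]

/-- `ι x + c e₅` is the point of height `ι₅ x + c` on the vertical line through `ι x`. [folklore] -/
theorem add_smul_axis_eq_vert (z : (EuclideanSpace ℝ (Fin 6))) (c : ℝ) :
    z + c • (axis : (EuclideanSpace ℝ (Fin 6))) = padL (truncL z) + (z 5 + c) • (axis : (EuclideanSpace ℝ (Fin
          6))) := by
  conv_lhs => rw [eq_vert z]
  rw [add_smul, add_assoc]

/-- **The two sides.** There are `t₀ > 0` and two truth values `a₊, a₋` such that every point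
pushed off `ι(M)` by `t ν` (`0 < t ≤ t₀`), resp. `-t ν`, and normalised onto `N`, lies in
`N ∖ ι(M)` and is on the lower side iff `a₊`, resp. `a₋` (uniform push-off + path-connectedness of
`M × (0, t₀]`). [folklore] -/
theorem exists_side_constants [T2Space M] [CompactSpace M] [ConnectedSpace M] {ι ν : M → (EuclideanSpace ℝ (Fin 6))}
    (hι : Manifold.IsSmoothEmbedding (𝓡 4) (𝓡 6) ∞ ι)
    (hιN : ∀ x, ∑ i : Fin 5, ι x (Fin.castSucc i) ^ 2 = 1)
    (hνc : Continuous ν) (hνn : (euclideanMetric (EuclideanSpace ℝ (Fin 6))).IsUnitNormal (𝓡 4) ι ν 1)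
    (hνt : ∀ x, ∑ i : Fin 5, ν x (Fin.castSucc i) * ι x (Fin.castSucc i) = 0) (R : ℝ) :
    ∃ t₀ : ℝ, 0 < t₀ ∧ ∃ aP aM : Prop,
      (∀ x, ∀ t ∈ Ioc (0 : ℝ) t₀, (fun z : EuclideanSpace ℝ (Fin 6) => (‖truncL z‖⁻¹ : ℝ) • (z - z (5 : Fin 6) •
            (axis : EuclideanSpace ℝ (Fin 6))) + z (5 : Fin 6) • (axis : EuclideanSpace ℝ (Fin 6))) (ι x + t • ν x)
            ∈ ({z : EuclideanSpace ℝ (Fin 6) | ∑ i : Fin 5, z (Fin.castSucc i) ^ 2 = 1} : Set (EuclideanSpace ℝ (Fin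
            6))) \ range ι ∧
        ((∃ b : EuclideanSpace ℝ (Fin 6), (∑ i : Fin 5, b (Fin.castSucc i) ^ 2 = 1) ∧ b (5 : Fin 6) ≤ -R ∧ JoinedIn
              (({z : EuclideanSpace ℝ (Fin 6) | ∑ i : Fin 5, z (Fin.castSucc i) ^ 2 = 1} : Set (EuclideanSpace ℝ
              (Fin 6))) \ Set.range ι) ((fun z : EuclideanSpace ℝ (Fin 6) => (‖truncL z‖⁻¹ : ℝ) • (z - z (5 : Fin 6)
              • (axis : EuclideanSpace ℝ (Fin 6))) + z (5 : Fin 6) • (axis : EuclideanSpace ℝ (Fin 6))) (ι x + t • ν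
              x)) b) ↔ aP)) ∧
      (∀ x, ∀ t ∈ Ioc (0 : ℝ) t₀, (fun z : EuclideanSpace ℝ (Fin 6) => (‖truncL z‖⁻¹ : ℝ) • (z - z (5 : Fin 6) •
            (axis : EuclideanSpace ℝ (Fin 6))) + z (5 : Fin 6) • (axis : EuclideanSpace ℝ (Fin 6))) (ι x + t • (-ν
            x)) ∈ ({z : EuclideanSpace ℝ (Fin 6) | ∑ i : Fin 5, z (Fin.castSucc i) ^ 2 = 1} : Set (EuclideanSpace ℝ
            (Fin 6))) \ range ι ∧
        ((∃ b : EuclideanSpace ℝ (Fin 6), (∑ i : Fin 5, b (Fin.castSucc i) ^ 2 = 1) ∧ b (5 : Fin 6) ≤ -R ∧ JoinedIn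
              (({z : EuclideanSpace ℝ (Fin 6) | ∑ i : Fin 5, z (Fin.castSucc i) ^ 2 = 1} : Set (EuclideanSpace ℝ
              (Fin 6))) \ Set.range ι) ((fun z : EuclideanSpace ℝ (Fin 6) => (‖truncL z‖⁻¹ : ℝ) • (z - z (5 : Fin 6)
              • (axis : EuclideanSpace ℝ (Fin 6))) + z (5 : Fin 6) • (axis : EuclideanSpace ℝ (Fin 6))) (ι x + t •
              (-ν x))) b) ↔ aM)) := by
  haveI : TopologicalSpace.MetrizableSpace M := Manifold.metrizableSpace (𝓡 4) M
  haveI : LocallyPathConnectedSpace M := ChartedSpace.locallyPathConnectedSpace (EuclideanSpace ℝ (Fin 4)) M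
  haveI : PathConnectedSpace M := pathConnectedSpace_iff_connectedSpace.2 inferInstance
  have hιc : Continuous ι := hι.contMDiff.continuous
  have hνt' : ∀ x, ∑ i : Fin 5, (-ν x) (Fin.castSucc i) * ι x (Fin.castSucc i) = 0 := fun x => by
    simp only [PiLp.neg_apply, neg_mul, Finset.sum_neg_distrib, hνt x, neg_zero]
  obtain ⟨t₁, ht₁, h₁⟩ := exists_pushoff_notMem_range hι hιN hνn (P := M) (f := fun x => x)
    (g := ν) continuous_id hνc hνt fun x => by
      show ⟪ν x, ν x⟫ ≠ 0
      rw [real_inner_self_eq_norm_sq, norm_nu hνn]; norm_num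
  obtain ⟨t₂, ht₂, h₂⟩ := exists_pushoff_notMem_range hι hιN hνn (P := M) (f := fun x => x)
    (g := fun x => -ν x) continuous_id hνc.neg hνt' fun x => by
      show ⟪-ν x, ν x⟫ ≠ 0
      rw [inner_neg_left, real_inner_self_eq_norm_sq, norm_nu hνn]; norm_num
  set t₀ := min t₁ t₂ with ht₀
  have ht₀0 : 0 < t₀ := lt_min ht₁ ht₂
  obtain ⟨x₀⟩ := (inferInstance : Nonempty M)
  -- a general connecting argument for a continuous direction field `τ` tangent to `N`
  have key : ∀ τ : M → (EuclideanSpace ℝ (Fin 6)), Continuous τ → (∀ x, ∑ i : Fin 5, τ x (Fin.castSucc i) * ι x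
        (Fin.castSucc i) = 0) →
      (∀ x, ∀ t ∈ Ioc (0 : ℝ) t₀, (fun z : EuclideanSpace ℝ (Fin 6) => (‖truncL z‖⁻¹ : ℝ) • (z - z (5 : Fin 6) •
            (axis : EuclideanSpace ℝ (Fin 6))) + z (5 : Fin 6) • (axis : EuclideanSpace ℝ (Fin 6))) (ι x + t • τ x)
            ∉ range ι) →
      ∀ x, ∀ t ∈ Ioc (0 : ℝ) t₀, JoinedIn (({z : EuclideanSpace ℝ (Fin 6) | ∑ i : Fin 5, z (Fin.castSucc i) ^ 2 = 1}
            : Set (EuclideanSpace ℝ (Fin 6))) \ range ι) ((fun z : EuclideanSpace ℝ (Fin 6) => (‖truncL z‖⁻¹ : ℝ) •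
            (z - z (5 : Fin 6) • (axis : EuclideanSpace ℝ (Fin 6))) + z (5 : Fin 6) • (axis : EuclideanSpace ℝ (Fin
            6))) (ι x + t • τ x)) ((fun z : EuclideanSpace ℝ (Fin 6) => (‖truncL z‖⁻¹ : ℝ) • (z - z (5 : Fin 6) •
            (axis : EuclideanSpace ℝ (Fin 6))) + z (5 : Fin 6) • (axis : EuclideanSpace ℝ (Fin 6))) (ι x₀ + t₀ • τ
            x₀)) := by
    intro τ hτc hτt hτ x t ht
    set Ψ : M × ℝ → (EuclideanSpace ℝ (Fin 6)) := fun q => (fun z : EuclideanSpace ℝ (Fin 6) => (‖truncL z‖⁻¹ : ℝ) •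
          (z - z (5 : Fin 6) • (axis : EuclideanSpace ℝ (Fin 6))) + z (5 : Fin 6) • (axis : EuclideanSpace ℝ (Fin
          6))) (ι q.1 + q.2 • τ q.1) with hΨ
    have hinner : Continuous fun q : M × ℝ => ι q.1 + q.2 • τ q.1 :=
      (hιc.comp continuous_fst).add (continuous_snd.smul (hτc.comp continuous_fst))
    have hΨc : ContinuousOn Ψ (univ ×ˢ Ioc (0 : ℝ) t₀) := by
      refine (continuousOn_nrm.comp hinner.continuousOn fun q _ => ?_)
      exact (norm_nrm_sub_le (hιN q.1) (hτt q.1) q.2).1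
    have hpc : IsPathConnected (Ψ '' (univ ×ˢ Ioc (0 : ℝ) t₀)) :=
      (isPathConnected_univ.prod ((convex_Ioc (0 : ℝ) t₀).isPathConnected ⟨t₀, ht₀0, le_rfl⟩)).image' hΨc
    have hsub : Ψ '' (univ ×ˢ Ioc (0 : ℝ) t₀) ⊆ ({z : EuclideanSpace ℝ (Fin 6) | ∑ i : Fin 5, z (Fin.castSucc i) ^ 2
          = 1} : Set (EuclideanSpace ℝ (Fin 6))) \ range ι := by
      rintro _ ⟨⟨y, s⟩, ⟨-, hs⟩, rfl⟩
      exact nrm_pushoff_mem hιN (hτt y) (hτ y s hs)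
    exact (hpc.joinedIn (Ψ (x, t)) (mem_image_of_mem Ψ ⟨mem_univ _, ht⟩) (Ψ (x₀, t₀))
      (mem_image_of_mem Ψ ⟨mem_univ _, ht₀0, le_rfl⟩)).mono hsub
  have hν₁ : ∀ x, ∀ t ∈ Ioc (0 : ℝ) t₀, (fun z : EuclideanSpace ℝ (Fin 6) => (‖truncL z‖⁻¹ : ℝ) • (z - z (5 : Fin 6)
        • (axis : EuclideanSpace ℝ (Fin 6))) + z (5 : Fin 6) • (axis : EuclideanSpace ℝ (Fin 6))) (ι x + t • ν
        x) ∉ range ι := fun x t ht =>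
    h₁ x t ⟨ht.1, ht.2.trans (min_le_left _ _)⟩
  have hν₂ : ∀ x, ∀ t ∈ Ioc (0 : ℝ) t₀, (fun z : EuclideanSpace ℝ (Fin 6) => (‖truncL z‖⁻¹ : ℝ) • (z - z (5 : Fin 6)
        • (axis : EuclideanSpace ℝ (Fin 6))) + z (5 : Fin 6) • (axis : EuclideanSpace ℝ (Fin 6))) (ι x + t • (-ν
        x)) ∉ range ι := fun x t ht =>
    h₂ x t ⟨ht.1, ht.2.trans (min_le_right _ _)⟩
  refine ⟨t₀, ht₀0, (∃ b : EuclideanSpace ℝ (Fin 6), (∑ i : Fin 5, b (Fin.castSucc i) ^ 2 = 1) ∧ b (5 : Fin 6) ≤ -R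
        ∧ JoinedIn (({z : EuclideanSpace ℝ (Fin 6) | ∑ i : Fin 5, z (Fin.castSucc i) ^ 2 = 1} : Set (EuclideanSpace
        ℝ (Fin 6))) \ Set.range ι) ((fun z : EuclideanSpace ℝ (Fin 6) => (‖truncL z‖⁻¹ : ℝ) • (z - z (5 : Fin 6) •
        (axis : EuclideanSpace ℝ (Fin 6))) + z (5 : Fin 6) • (axis : EuclideanSpace ℝ (Fin 6))) (ι x₀ + t₀ • ν x₀))
        b), (∃ b : EuclideanSpace ℝ (Fin 6), (∑ i : Fin 5, b (Fin.castSucc i) ^ 2 = 1) ∧ b (5 : Fin 6) ≤ -R ∧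
        JoinedIn (({z : EuclideanSpace ℝ (Fin 6) | ∑ i : Fin 5, z (Fin.castSucc i) ^ 2 = 1} : Set (EuclideanSpace ℝ
        (Fin 6))) \ Set.range ι) ((fun z : EuclideanSpace ℝ (Fin 6) => (‖truncL z‖⁻¹ : ℝ) • (z - z (5 : Fin 6) •
        (axis : EuclideanSpace ℝ (Fin 6))) + z (5 : Fin 6) • (axis : EuclideanSpace ℝ (Fin 6))) (ι x₀ + t₀ • (-ν
        x₀))) b),
    fun x t ht => ⟨nrm_pushoff_mem hιN (hνt x) (hν₁ x t ht), ?_⟩,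
    fun x t ht => ⟨nrm_pushoff_mem hιN (hνt' x) (hν₂ x t ht), ?_⟩⟩
  · exact low_iff_of_joinedIn (key ν hνc hνt hν₁ x t ht)
  · exact low_iff_of_joinedIn (key (fun x => -ν x) hνc.neg hνt' hν₂ x t ht)

/-- Convex combinations of two positive numbers do not vanish. [folklore] -/
theorem convexComb_ne_zero_of_pos {A B s : ℝ} (hA : 0 < A) (hB : 0 < B) (hs0 : 0 ≤ s) (hs1 : s ≤ 1) :
    (1 - s) * A + s * B ≠ 0 := by
  rcases hs1.lt_or_eq with h | rfl
  · nlinarith [mul_pos (sub_pos.2 h) hA, mul_nonneg hs0 hB.le]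
  · norm_num; exact hB.ne'

/-- Convex combinations of two negative numbers do not vanish. [folklore] -/
theorem convexComb_ne_zero_of_neg {A B s : ℝ} (hA : A < 0) (hB : B < 0) (hs0 : 0 ≤ s) (hs1 : s ≤ 1) :
    (1 - s) * A + s * B ≠ 0 := by
  have := convexComb_ne_zero_of_pos (neg_pos.2 hA) (neg_pos.2 hB) hs0 hs1
  intro h; apply this; linarith

/-- **Crossing a regular point of the cross-section along the vertical line.** Let `x` be a
point with `ν₅(x) ≠ 0` and let `(p, h) = ι x`. For all small `δ > 0` the point `(p, h + δ)` just
above is on the side into which `sign(ν₅) ν` points, and `(p, h - δ)` on the other one: e.g. for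
`ν₅ > 0`, `ι x + δ e₅` is joined to the push-off `nrm(ι x + δ ν)` through the push-offs in the
directions `(1-s) ν + s e₅`, all transverse (`exists_joinedIn_pushoffs`). [folklore] -/
theorem low_vert_iff_near_crossing {ι ν : M → (EuclideanSpace ℝ (Fin 6))}
    (hι : Manifold.IsSmoothEmbedding (𝓡 4) (𝓡 6) ∞ ι)
    (hιN : ∀ x, ∑ i : Fin 5, ι x (Fin.castSucc i) ^ 2 = 1)
    (hνn : (euclideanMetric (EuclideanSpace ℝ (Fin 6))).IsUnitNormal (𝓡 4) ι ν 1)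
    (hνt : ∀ x, ∑ i : Fin 5, ν x (Fin.castSucc i) * ι x (Fin.castSucc i) = 0) {R t₀ : ℝ}
    {aP aM : Prop}
    (hP : ∀ x, ∀ t ∈ Ioc (0 : ℝ) t₀, (∃ b : EuclideanSpace ℝ (Fin 6), (∑ i : Fin 5, b (Fin.castSucc i) ^ 2 = 1) ∧ b
          (5 : Fin 6) ≤ -R ∧ JoinedIn (({z : EuclideanSpace ℝ (Fin 6) | ∑ i : Fin 5, z (Fin.castSucc i) ^ 2 = 1} :
          Set (EuclideanSpace ℝ (Fin 6))) \ Set.range ι) ((fun z : EuclideanSpace ℝ (Fin 6) => (‖truncL z‖⁻¹ : ℝ) •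
          (z - z (5 : Fin 6) • (axis : EuclideanSpace ℝ (Fin 6))) + z (5 : Fin 6) • (axis : EuclideanSpace ℝ (Fin
          6))) (ι x + t • ν x)) b) ↔ aP)
    (hM : ∀ x, ∀ t ∈ Ioc (0 : ℝ) t₀, (∃ b : EuclideanSpace ℝ (Fin 6), (∑ i : Fin 5, b (Fin.castSucc i) ^ 2 = 1) ∧ b
          (5 : Fin 6) ≤ -R ∧ JoinedIn (({z : EuclideanSpace ℝ (Fin 6) | ∑ i : Fin 5, z (Fin.castSucc i) ^ 2 = 1} :
          Set (EuclideanSpace ℝ (Fin 6))) \ Set.range ι) ((fun z : EuclideanSpace ℝ (Fin 6) => (‖truncL z‖⁻¹ : ℝ) •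
          (z - z (5 : Fin 6) • (axis : EuclideanSpace ℝ (Fin 6))) + z (5 : Fin 6) • (axis : EuclideanSpace ℝ (Fin
          6))) (ι x + t • (-ν x))) b) ↔ aM) (ht₀ : 0 < t₀)
    {x : M} (hx : ν x 5 ≠ 0) :
    ∃ δ₀ : ℝ, 0 < δ₀ ∧ ∀ δ ∈ Ioc (0 : ℝ) δ₀,
      ((∃ b : EuclideanSpace ℝ (Fin 6), (∑ i : Fin 5, b (Fin.castSucc i) ^ 2 = 1) ∧ b (5 : Fin 6) ≤ -R ∧ JoinedIn
            (({z : EuclideanSpace ℝ (Fin 6) | ∑ i : Fin 5, z (Fin.castSucc i) ^ 2 = 1} : Set (EuclideanSpace ℝ (Fin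
            6))) \ Set.range ι) (padL (truncL (ι x)) + (ι x 5 + δ) • (axis : (EuclideanSpace ℝ (Fin 6)))) b) ↔ (if 0
            < ν x 5 then aP else aM)) ∧
      ((∃ b : EuclideanSpace ℝ (Fin 6), (∑ i : Fin 5, b (Fin.castSucc i) ^ 2 = 1) ∧ b (5 : Fin 6) ≤ -R ∧ JoinedIn
            (({z : EuclideanSpace ℝ (Fin 6) | ∑ i : Fin 5, z (Fin.castSucc i) ^ 2 = 1} : Set (EuclideanSpace ℝ (Fin
            6))) \ Set.range ι) (padL (truncL (ι x)) + (ι x 5 - δ) • (axis : (EuclideanSpace ℝ (Fin 6)))) b) ↔ (if 0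
            < ν x 5 then aM else aP)) := by
  have hνt' : ∑ i : Fin 5, (-ν x) (Fin.castSucc i) * ι x (Fin.castSucc i) = 0 := by
    simp only [PiLp.neg_apply, neg_mul, Finset.sum_neg_distrib, hνt x, neg_zero]
  have hax : ∑ i : Fin 5, (axis : (EuclideanSpace ℝ (Fin 6))) (Fin.castSucc i) * ι x (Fin.castSucc i) = 0 := by
    simpa using sum_axis_mul 1 (ι x)
  have hax' : ∑ i : Fin 5, (-(axis : (EuclideanSpace ℝ (Fin 6)))) (Fin.castSucc i) * ι x (Fin.castSucc i) = 0 := by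
    simpa using sum_axis_mul (-1) (ι x)
  have hνν : ⟪ν x, ν x⟫ = 1 := by rw [real_inner_self_eq_norm_sq, norm_nu hνn]; norm_num
  have haν : ⟪(axis : (EuclideanSpace ℝ (Fin 6))), ν x⟫ = ν x 5 := inner_axis_left _
  -- normalised vertical push-offs are the points `(p, h ± t)`
  have hup : ∀ t : ℝ, (fun z : EuclideanSpace ℝ (Fin 6) => (‖truncL z‖⁻¹ : ℝ) • (z - z (5 : Fin 6) • (axis :
        EuclideanSpace ℝ (Fin 6))) + z (5 : Fin 6) • (axis : EuclideanSpace ℝ (Fin 6))) (ι x + t • (axis :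
        (EuclideanSpace ℝ (Fin 6)))) = padL (truncL (ι x)) + (ι x 5 + t) • (axis : (EuclideanSpace ℝ (Fin 6))) := by
    intro t
    have hmem : ∑ i : Fin 5, (ι x + t • (axis : (EuclideanSpace ℝ (Fin 6)))) (Fin.castSucc i) ^ 2 = 1 := by
      simp [axis, castSucc_ne_five, hιN x]
    have := nrm_eq_self hmem
    beta_reduce at this ⊢
    rw [this, add_smul_axis_eq_vert]
  have hdown : ∀ t : ℝ, (fun z : EuclideanSpace ℝ (Fin 6) => (‖truncL z‖⁻¹ : ℝ) • (z - z (5 : Fin 6) • (axis :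
        EuclideanSpace ℝ (Fin 6))) + z (5 : Fin 6) • (axis : EuclideanSpace ℝ (Fin 6))) (ι x + t • (-(axis :
        (EuclideanSpace ℝ (Fin 6))))) = padL (truncL (ι x)) + (ι x 5 - t) • (axis : (EuclideanSpace ℝ (Fin
        6))) := by
    intro t
    have hmem : ∑ i : Fin 5, (ι x + t • (-(axis : (EuclideanSpace ℝ (Fin 6))))) (Fin.castSucc i) ^ 2 = 1 := by
      simp [axis, castSucc_ne_five, hιN x]
    have := nrm_eq_self hmem
    beta_reduce at this ⊢
    rw [this, smul_neg, ← neg_smul, add_smul_axis_eq_vert, ← sub_eq_add_neg]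
  rcases lt_or_gt_of_ne hx with hneg | hpos
  · -- `ν₅ < 0`: above is the `-ν` side, below the `+ν` side
    obtain ⟨t₁, ht₁, hj₁⟩ := exists_joinedIn_pushoffs hι hιN hνn x hνt' hax fun s hs => by
      rw [inner_add_left, real_inner_smul_left, real_inner_smul_left, inner_neg_left, hνν, haν]
      exact convexComb_ne_zero_of_neg (by norm_num) hneg hs.1 hs.2
    obtain ⟨t₂, ht₂, hj₂⟩ := exists_joinedIn_pushoffs hι hιN hνn x (hνt x) hax' fun s hs => by
      rw [inner_add_left, real_inner_smul_left, real_inner_smul_left, inner_neg_left, hνν, haν]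
      exact convexComb_ne_zero_of_pos one_pos (neg_pos.2 hneg) hs.1 hs.2
    refine ⟨min t₀ (min t₁ t₂), lt_min ht₀ (lt_min ht₁ ht₂), fun δ hδ => ?_⟩
    have hδ₀ : δ ∈ Ioc (0 : ℝ) t₀ := ⟨hδ.1, hδ.2.trans (min_le_left _ _)⟩
    have hδ₁ : δ ∈ Ioc (0 : ℝ) t₁ := ⟨hδ.1, hδ.2.trans ((min_le_right _ _).trans (min_le_left _ _))⟩
    have hδ₂ : δ ∈ Ioc (0 : ℝ) t₂ := ⟨hδ.1, hδ.2.trans ((min_le_right _ _).trans (min_le_right _ _))⟩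
    rw [if_neg (not_lt.2 hneg.le), if_neg (not_lt.2 hneg.le)]
    constructor
    · have h := hj₁ δ hδ₁
      rw [hup] at h
      rw [← low_iff_of_joinedIn h]
      exact hM x δ hδ₀
    · have h := hj₂ δ hδ₂
      rw [hdown] at h
      rw [← low_iff_of_joinedIn h]
      exact hP x δ hδ₀
  · -- `ν₅ > 0`: above is the `+ν` side, below the `-ν` side
    obtain ⟨t₁, ht₁, hj₁⟩ := exists_joinedIn_pushoffs hι hιN hνn x (hνt x) hax fun s hs => by
      rw [inner_add_left, real_inner_smul_left, real_inner_smul_left, hνν, haν]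
      exact convexComb_ne_zero_of_pos one_pos hpos hs.1 hs.2
    obtain ⟨t₂, ht₂, hj₂⟩ := exists_joinedIn_pushoffs hι hιN hνn x hνt' hax' fun s hs => by
      rw [inner_add_left, real_inner_smul_left, real_inner_smul_left, inner_neg_left, inner_neg_left,
        hνν, haν]
      exact convexComb_ne_zero_of_neg (by norm_num) (neg_neg_of_pos hpos) hs.1 hs.2
    refine ⟨min t₀ (min t₁ t₂), lt_min ht₀ (lt_min ht₁ ht₂), fun δ hδ => ?_⟩
    have hδ₀ : δ ∈ Ioc (0 : ℝ) t₀ := ⟨hδ.1, hδ.2.trans (min_le_left _ _)⟩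
    have hδ₁ : δ ∈ Ioc (0 : ℝ) t₁ := ⟨hδ.1, hδ.2.trans ((min_le_right _ _).trans (min_le_left _ _))⟩
    have hδ₂ : δ ∈ Ioc (0 : ℝ) t₂ := ⟨hδ.1, hδ.2.trans ((min_le_right _ _).trans (min_le_right _ _))⟩
    rw [if_pos hpos, if_pos hpos]
    constructor
    · have h := hj₁ δ hδ₁
      rw [hup] at h
      rw [← low_iff_of_joinedIn h]
      exact hP x δ hδ₀
    · have h := hj₂ δ hδ₂
      rw [hdown] at h
      rw [← low_iff_of_joinedIn h]
      exact hM x δ hδ₀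

end Sides

end Normalisation

/-- Marker of part 6 (registered sub-goal `stub_fluxIdentity_part6`): convex combinations of
positive numbers do not vanish (`convexComb_ne_zero_of_pos`, the transversality of the
connecting directions). [folklore] -/
theorem stub_fluxIdentity_part6 :
    ∀ A B s : ℝ, 0 < A → 0 < B → 0 ≤ s → s ≤ 1 → (1 - s) * A + s * B ≠ 0 :=
  fun _ _ _ hA hB hs0 hs1 => convexComb_ne_zero_of_pos hA hB hs0 hs1

end Summit.SmoothPoincare4.SmoothPoincare4.Theorems.CylinderRungTwo.KillingFlux
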